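import Literature.NumberTheory.EllipticCurves.Rubin1983.BernoulliDescentSeven
import Literature.NumberTheory.EllipticCurves.KrizLi2019.TeichmullerCharacterExists
import Literature.NumberTheory.EllipticCurves.QuadraticTwistJInvariantProofs
import Literature.NumberTheory.QuadraticFields.KroneckerSplitting
import Literature.NumberTheory.QuadraticFields.FundamentalDiscriminant
import Summits.BirchSwinnertonDyer.Rank1Residual.X12.O11.RouteUPsiD11
import Summits.BirchSwinnertonDyer.Rank1Residual.X12.O11.RouteUTwistCM
import Summits.BirchSwinnertonDyer.Rank1Residual.X12.O11.RouteUTwistReduction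
import Summits.BirchSwinnertonDyer.Rank1Residual.X11b.Three.CornerDischarge
import Literature.NumberTheory.EllipticCurves.BSDRootNumberSmallConductorAssemblyProofs
import Literature.NumberTheory.EllipticCurves.AnalyticRankOrderProofs
import Literature.NumberTheory.EllipticCurves.LFunctionSmulProofs
import Mathlib.NumberTheory.LegendreSymbol.JacobiSymbol
import Mathlib.Tactic.NormNum.LegendreSymbol
import HarnessLib

/-!
# ROUTE U — the GENERIC quadratic-field / twin layer: the Kronecker character of a quadratic field
# IS the Jacobi character; the Heegner field `ℚ(√−r)`; twists of twists of `49a1`; the twin's CM and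
# VALUE binder (Burungale–Flach BY NAME)

bsd-cm cell (run/shared/lean/pub/bsd-cm/), ROUTE U (Theorem U: BSD(49a1^{(D)}, 7) ⇒ full BSD on `𝒞₇`),
seat `bsd-cm-ram`; planner ORDER «generic-q refactor». This module collects the parts of the twin side
and of the Heegner-field bookkeeping that do not depend on any Bernoulli certificate, so that the
member file `RouteUTwinD11` (`D = −11`) and the prime-member class theorem `RouteUPrimeMember` both
import it. THEOREMS ONLY; no definitions (one `Prop`-instance `NeZero (q·r)` registered as a theorem),
no named facts; nothing booked; nothing asserted about any particular curve.

* §1 `kroneckerValue_of_discr_eq_pos` / `kroneckerValue_of_discr_eq_neg` /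
  `isKroneckerCharacterOf_changeLevel_jacobi` — for ANY quadratic number field `M` with `d_M = m`
  (`m ≡ 1 (mod 4)`) or `d_M = −m` (`m ≡ 3 (mod 4)`), a primitive character mod `m` with values
  `J(· | m)` IS the Kronecker character of `M` (decomposition law
  `Quadratic.ncard_primesOver_eq_two_iff_legendreSym` / `…_two_eq_two_iff` + Jacobi reciprocity, both
  signs; at `2` the character `χ₈`).
* §2 the Heegner field `K = ℚ(√−r)`: splitting from `(d_K/ℓ) = 1`; the Heegner hypothesis for
  `(N(W), K)` when the bad primes of `W` lie in `{7, q}`; for a model `W` of `49a1^{(−q)}` (`q ≡ 3 (4)`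
  prime) every bad prime `≠ 7` is `q`.
* §3 twists: `(49a1^{(d)})^{(d')} ≅_ℚ 49a1^{(dd')}` on models; `q·r` (`q ≠ r` primes `≡ 3 (mod 4)`) is
  a fundamental discriminant; the twin `Wd ≅ 49a1^{(qr)}` is CM; its VALUE binder `htw`
  (`L(Wd,1)/Ω ∈ ℚ` with the BSD₇ valuation) from the published named fact Burungale–Flach 2024
  (`bsdTriple_of_hasCM_of_L_one_ne_zero`) BY NAME + GZK/`hmod` bookkeeping
  (`X11b.Three.exists_LOne_div_realPeriodRat_of_bsdp_rankZero`).

References: [Cox2013] §1.C Lemma 1.14, (1.18); [KrizLi2019] §2 (p. 12), Thm. 1.20 (p. 7);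
[GrossLMS1991] §1; [SilvermanAEC2009] X.2 Prop. 2.4, X.5 Cor. 5.4; [SilvermanATAEC1994] App. A §3;
[BurungaleFlach2024] Thm 1.1 / Cor. 2; [Miller2011LMS] Def. 1.1.
-/

noncomputable section

open scoped Classical
open NumberField WeierstrassCurve DirichletCharacter
open Literature.NumberTheory.EllipticCurves Literature.NumberTheory.EllipticCurves.Rank1Residual
open Literature.NumberTheory.EllipticCurves.KrizLi2019 Literature.NumberTheory.LFunctions
open Literature.NumberTheory.QuadraticFields

namespace Summit.BirchSwinnertonDyer.Rank1Residual.X12.O11.RouteU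

/-! ## §1 The Kronecker character of a quadratic field is the Jacobi character -/

section Kronecker

variable {M : Type} [Field M] [NumberField M]

/-- **Decomposition law read on the Jacobi character, positive discriminant `m ≡ 1 (mod 4)`**:
if `d_M = m` and `κ` (any level) has values `J(· | m)`, then for every prime `ℓ ∤ d_M`:
`κ(ℓ) = 1` if `ℓ` splits in `M`, `−1` otherwise (`J(ℓ | m) = J(m | ℓ) = (d_M/ℓ)`; at `2`:
`χ₈(m) = 1 ⟺ m ≡ 1 (mod 8)`). [cite: Cox2013, §1.C Lemma 1.14 and (1.18)] -/
theorem kroneckerValue_of_discr_eq_pos (hM2 : Module.finrank ℚ M = 2) {m : ℕ} (hm4 : m % 4 = 1)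
    (hdM : NumberField.discr M = m) {n : ℕ} (κ : DirichletCharacter ℚ_[7] n)
    (hκ : ∀ a : ℕ, κ (a : ZMod n) = (jacobiSym a m : ℚ_[7]))
    (ℓ : ℕ) (hℓ : ℓ.Prime) (hnd : ¬ ((ℓ : ℤ) ∣ NumberField.discr M)) :
    κ (ℓ : ZMod n) = if ((Ideal.span {(ℓ : ℤ)}).primesOver (𝓞 M)).ncard = 2 then 1 else -1 := by
  have hmodd : Odd m := Nat.odd_iff.mpr (by omega)
  have hcop : (ℓ : ℤ).gcd m = 1 := by
    rw [Int.gcd_natCast_natCast, ← Nat.coprime_iff_gcd_eq_one, Nat.Prime.coprime_iff_not_dvd hℓ]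
    intro h; apply hnd; rw [hdM]; exact_mod_cast h
  rw [hκ ℓ]
  by_cases h2 : ℓ = 2
  · subst h2
    have hJ : jacobiSym 2 m = ZMod.χ₈ m := by exact_mod_cast jacobiSym.at_two hmodd
    have h8 := ZMod.χ₈_nat_eq_if_mod_eight m
    by_cases hs : ((Ideal.span {((2 : ℕ) : ℤ)}).primesOver (𝓞 M)).ncard = 2
    · rw [if_pos hs]
      have h1 : NumberField.discr M % 8 = 1 := by
        rw [Nat.cast_ofNat, Quadratic.ncard_primesOver_two_eq_two_iff hM2] at hs; exact hs
      rw [hdM] at h1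
      have : m % 8 = 1 := by omega
      rw [Nat.cast_ofNat, hJ, h8, if_neg (by omega), if_pos (Or.inl this)]; simp
    · rw [if_neg hs]
      have h1 : NumberField.discr M % 8 ≠ 1 := by
        rw [Nat.cast_ofNat, Quadratic.ncard_primesOver_two_eq_two_iff hM2] at hs; exact hs
      rw [hdM] at h1
      have : ¬ (m % 8 = 1 ∨ m % 8 = 7) := by omega
      rw [Nat.cast_ofNat, hJ, h8, if_neg (by omega), if_neg this]; simp
  · haveI := Fact.mk hℓ
    have hodd : Odd ℓ := hℓ.odd_of_ne_two h2
    have hrec : jacobiSym ℓ m = legendreSym ℓ (NumberField.discr M) := by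
      rw [hdM, jacobiSym.legendreSym.to_jacobiSym, jacobiSym.quadratic_reciprocity_one_mod_four' hodd hm4]
    rcases jacobiSym.eq_one_or_neg_one hcop with h1 | h1
    · rw [h1, if_pos ((Quadratic.ncard_primesOver_eq_two_iff_legendreSym hM2 h2).mpr (by rw [← hrec, h1])),
        Int.cast_one]
    · have hs : ((Ideal.span {(ℓ : ℤ)}).primesOver (𝓞 M)).ncard ≠ 2 := fun hs => by
        have := (Quadratic.ncard_primesOver_eq_two_iff_legendreSym hM2 h2).mp hs
        rw [← hrec, h1] at this; norm_num at this
      rw [h1, if_neg hs, Int.cast_neg, Int.cast_one]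

/-- **Decomposition law read on the Jacobi character, negative discriminant `−m`, `m ≡ 3 (mod 4)`**:
if `d_M = −m` and `κ` has values `J(· | m)`, then `κ(ℓ) = ±1` by splitting, for every prime
`ℓ ∤ d_M` (`J(ℓ | m) = χ₄(ℓ)J(m | ℓ) = J(−m | ℓ)`; at `2`: `χ₈(m) = 1 ⟺ m ≡ 7 (8) ⟺ −m ≡ 1 (8)`).
[cite: Cox2013, §1.C Lemma 1.14 and (1.18)] -/
theorem kroneckerValue_of_discr_eq_neg (hM2 : Module.finrank ℚ M = 2) {m : ℕ} (hm4 : m % 4 = 3)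
    (hdM : NumberField.discr M = -(m : ℤ)) {n : ℕ} (κ : DirichletCharacter ℚ_[7] n)
    (hκ : ∀ a : ℕ, κ (a : ZMod n) = (jacobiSym a m : ℚ_[7]))
    (ℓ : ℕ) (hℓ : ℓ.Prime) (hnd : ¬ ((ℓ : ℤ) ∣ NumberField.discr M)) :
    κ (ℓ : ZMod n) = if ((Ideal.span {(ℓ : ℤ)}).primesOver (𝓞 M)).ncard = 2 then 1 else -1 := by
  have hmodd : Odd m := Nat.odd_iff.mpr (by omega)
  have hcop : (ℓ : ℤ).gcd m = 1 := by
    rw [Int.gcd_natCast_natCast, ← Nat.coprime_iff_gcd_eq_one, Nat.Prime.coprime_iff_not_dvd hℓ]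
    intro h; apply hnd; rw [hdM, dvd_neg]; exact_mod_cast h
  rw [hκ ℓ]
  by_cases h2 : ℓ = 2
  · subst h2
    have hJ : jacobiSym 2 m = ZMod.χ₈ m := by exact_mod_cast jacobiSym.at_two hmodd
    have h8 := ZMod.χ₈_nat_eq_if_mod_eight m
    by_cases hs : ((Ideal.span {((2 : ℕ) : ℤ)}).primesOver (𝓞 M)).ncard = 2
    · rw [if_pos hs]
      have h1 : NumberField.discr M % 8 = 1 := by
        rw [Nat.cast_ofNat, Quadratic.ncard_primesOver_two_eq_two_iff hM2] at hs; exact hs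
      rw [hdM] at h1
      have : m % 8 = 7 := by omega
      rw [Nat.cast_ofNat, hJ, h8, if_neg (by omega), if_pos (Or.inr this)]; simp
    · rw [if_neg hs]
      have h1 : NumberField.discr M % 8 ≠ 1 := by
        rw [Nat.cast_ofNat, Quadratic.ncard_primesOver_two_eq_two_iff hM2] at hs; exact hs
      rw [hdM] at h1
      have : ¬ (m % 8 = 1 ∨ m % 8 = 7) := by omega
      rw [Nat.cast_ofNat, hJ, h8, if_neg (by omega), if_neg this]; simp
  · haveI := Fact.mk hℓ
    have hodd : Odd ℓ := hℓ.odd_of_ne_two h2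
    -- `J(ℓ | m) = J(−m | ℓ)`: split `ℓ mod 4`
    have hrec : jacobiSym ℓ m = legendreSym ℓ (NumberField.discr M) := by
      rw [hdM, jacobiSym.legendreSym.to_jacobiSym, jacobiSym.neg _ hodd]
      rcases Nat.odd_mod_four_iff.mp (Nat.odd_iff.mp hodd) with h1 | h3
      · rw [ZMod.χ₄_nat_one_mod_four h1, one_mul, jacobiSym.quadratic_reciprocity_one_mod_four h1 hmodd]
      · rw [ZMod.χ₄_nat_three_mod_four h3, jacobiSym.quadratic_reciprocity_three_mod_four h3 hm4]
        ring
    rcases jacobiSym.eq_one_or_neg_one hcop with h1 | h1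
    · rw [h1, if_pos ((Quadratic.ncard_primesOver_eq_two_iff_legendreSym hM2 h2).mpr (by rw [← hrec, h1])),
        Int.cast_one]
    · have hs : ((Ideal.span {(ℓ : ℤ)}).primesOver (𝓞 M)).ncard ≠ 2 := fun hs => by
        have := (Quadratic.ncard_primesOver_eq_two_iff_legendreSym hM2 h2).mp hs
        rw [← hrec, h1] at this; norm_num at this
      rw [h1, if_neg hs, Int.cast_neg, Int.cast_one]

/-- **The Kronecker character of a quadratic field `M` of discriminant `d_M = ±m` is `J(· | m)`
transported to level `|d_M|`**: if `κ` mod `m` is primitive with values `J(· | m)` and `h : m ∣ |d_M|`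
(in fact `|d_M| = m`), then `IsKroneckerCharacterOf M (changeLevel h κ)`, for either sign.
[cite: KrizLi2019, §2 (p. 12, "ε_K the quadratic character associated with K")]
[cite: Cox2013, §1.C Lemma 1.14] -/
theorem isKroneckerCharacterOf_changeLevel_jacobi (hM2 : Module.finrank ℚ M = 2) {m : ℕ} [NeZero m]
    (hsign : (NumberField.discr M = m ∧ m % 4 = 1) ∨ (NumberField.discr M = -(m : ℤ) ∧ m % 4 = 3))
    (κ : DirichletCharacter ℚ_[7] m) (hκp : κ.IsPrimitive)
    (hκ : ∀ a : ℕ, κ (a : ZMod m) = (jacobiSym a m : ℚ_[7]))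
    (h : m ∣ (NumberField.discr M).natAbs) :
    IsKroneckerCharacterOf M (changeLevel h κ) := by
  have hnat : (NumberField.discr M).natAbs = m := by
    rcases hsign with ⟨hd, -⟩ | ⟨hd, -⟩ <;> simp [hd]
  refine ⟨?_, fun ℓ hℓ hnd => ?_⟩
  · rw [isPrimitive_def, conductor_changeLevel, hκp, hnat]
  · have hcop : IsCoprime (ℓ : ℤ) ((NumberField.discr M).natAbs : ℕ) := by
      rw [Int.isCoprime_iff_gcd_eq_one, Int.gcd_natCast_natCast, ← Nat.coprime_iff_gcd_eq_one,
        Nat.Prime.coprime_iff_not_dvd hℓ]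
      intro hdvd; apply hnd
      exact Int.dvd_natAbs.mp (by exact_mod_cast hdvd)
    have hval : changeLevel h κ (ℓ : ZMod (NumberField.discr M).natAbs) = κ (ℓ : ZMod m) := by
      have := changeLevel_eq_cast_of_dvd' κ h hcop
      simpa [Int.cast_natCast] using this
    rw [hval]
    rcases hsign with ⟨hd, h4⟩ | ⟨hd, h4⟩
    · exact kroneckerValue_of_discr_eq_pos hM2 h4 hd κ hκ ℓ hℓ hnd
    · exact kroneckerValue_of_discr_eq_neg hM2 h4 hd κ hκ ℓ hℓ hnd

end Kronecker

/-! ## §2 The Heegner field `K'' = ℚ(√−r)` -/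

section HeegnerField

variable {K : Type} [Field K] [NumberField K]

/-- A prime `ℓ ≠ 2` with `(d_K/ℓ) = 1` splits in the quadratic field `K`. [folklore] -/
theorem ncard_primesOver_eq_two_of_legendreSym (hK : IsImaginaryQuadratic K) {ℓ : ℕ} [Fact ℓ.Prime]
    (hℓ2 : ℓ ≠ 2) (h : legendreSym ℓ (NumberField.discr K) = 1) :
    ((Ideal.span {(ℓ : ℤ)}).primesOver (𝓞 K)).ncard = 2 :=
  (Quadratic.ncard_primesOver_eq_two_iff_legendreSym hK.1 hℓ2).mpr h

omit [NumberField K] in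
/-- **Heegner hypothesis for `(N(W), K)`** when the bad primes of `W` lie in `{7, q}` and both `7`
and `q` split in `K`. [cite: GrossLMS1991, §1 (p. 235)] [cite: KrizLi2019, Thm. 1.20 (p. 7)] -/
theorem satisfiesHeegnerHypothesis_conductorNorm_of_badPrimes {q : ℕ}
    (h7 : ((Ideal.span {(7 : ℤ)}).primesOver (𝓞 K)).ncard = 2)
    (hq : ((Ideal.span {(q : ℤ)}).primesOver (𝓞 K)).ncard = 2)
    (W : WeierstrassCurve ℚ) [W.IsElliptic]
    (hbad : ∀ p : ℕ, (hp : p.Prime) → p ≠ 7 →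
      ¬ (haveI := Fact.mk hp; W.HasGoodReductionAtPrime p) → p = q) :
    SatisfiesHeegnerHypothesis (W.conductorNorm ℤ) K := by
  intro p hp hpN
  by_cases hp7 : p = 7
  · subst hp7; exact_mod_cast h7
  · haveI := Fact.mk hp
    have hpq : p = q := hbad p hp hp7 fun hgood => not_dvd_conductorNorm_of_hasGoodReductionAtPrime W hgood hpN
    subst hpq; exact hq

/-- For `W` a model of `49a1^{(−q)}` (`q ≡ 3 (mod 4)` prime): a bad prime `ℓ ≠ 7` is `q`.
[cite: SilvermanAEC2009, X.§5 (conductor of a quadratic twist)] -/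
theorem eq_of_not_hasGoodReductionAtPrime_twist_cm7_prime {q : ℕ} (hq : q.Prime) (hq4 : q % 4 = 3)
    (W : WeierstrassCurve ℚ) [W.IsElliptic]
    (hW : ∃ C : VariableChange ℚ, C • W = cm7.quadraticTwist ((-(q : ℤ) : ℤ) : ℚ))
    (ℓ : ℕ) [hℓ : Fact ℓ.Prime] (h7 : ℓ ≠ 7) (hbad : ¬ W.HasGoodReductionAtPrime ℓ) : ℓ = q := by
  have hd : (ℓ : ℤ) ∣ (-(q : ℤ)) :=
    dvd_of_not_hasGoodReductionAtPrime_twist_cm7 W (by omega) hW ℓ h7 hbad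
  rw [dvd_neg] at hd
  have hd' : ℓ ∣ q := by exact_mod_cast hd
  exact (Nat.prime_dvd_prime_iff_eq hℓ.out hq).mp hd'

end HeegnerField

/-! ## §3 Twists of twists of `49a1`; the twin `49a1^{(qr)}` is CM; its value binder by name -/

/-- **`(49a1^{(d)})^{(d')} ≅_ℚ 49a1^{(dd')}` on models**: if `C • W = cm7^{(d)}` and
`Cd • W^{(d')} = Wd` then `Wd = C' • cm7^{(dd')}` for some change of variables `C'`
(`quadraticTwist_smul`, `quadraticTwist_quadraticTwist`). [cite: SilvermanAEC2009, X.2 Prop. 2.4 and X.5 Cor. 5.4] -/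
theorem exists_variableChange_cm7_twist_twist (W : WeierstrassCurve ℚ) {d d' : ℚ}
    (hW : ∃ C : VariableChange ℚ, C • W = cm7.quadraticTwist d)
    (Wd : WeierstrassCurve ℚ) (Cd : VariableChange ℚ) (hWd : Cd • W.quadraticTwist d' = Wd) :
    ∃ C' : VariableChange ℚ, C' • cm7.quadraticTwist (d * d') = Wd := by
  obtain ⟨C, hC⟩ := hW
  have hW' : W = C⁻¹ • cm7.quadraticTwist d := by rw [← hC, inv_smul_smul]
  rw [hW', quadraticTwist_smul, quadraticTwist_quadraticTwist, ← mul_smul] at hWd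
  exact ⟨_, hWd⟩

section Twin

variable {q r : ℕ} [hq : Fact q.Prime] [hr : Fact r.Prime]

/-- `q·r ≠ 0`. [folklore] -/
@[instance] theorem neZero_mul_primes : NeZero (q * r) := ⟨Nat.mul_ne_zero hq.out.ne_zero hr.out.ne_zero⟩

/-- `q·r` is a fundamental discriminant when `q ≠ r` are primes `≡ 3 (mod 4)`. [folklore] -/
theorem isFundamental_mul_primes (hqr : q ≠ r) (hq4 : q % 4 = 3) (hr4 : r % 4 = 3) :
    (((q * r : ℕ) : ℤ) % 4 = 1 ∧ Squarefree ((q * r : ℕ) : ℤ) ∧ ((q * r : ℕ) : ℤ) ≠ 1) ∨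
      (4 ∣ ((q * r : ℕ) : ℤ) ∧ (((q * r : ℕ) : ℤ) / 4 % 4 = 2 ∨ ((q * r : ℕ) : ℤ) / 4 % 4 = 3) ∧
        Squarefree (((q * r : ℕ) : ℤ) / 4)) := by
  refine Or.inl ⟨?_, ?_, ?_⟩
  · have : (q * r) % 4 = 1 := by rw [Nat.mul_mod, hq4, hr4]
    exact_mod_cast this
  · rw [Int.squarefree_natCast, Nat.squarefree_mul ((Nat.coprime_primes hq.out hr.out).mpr hqr)]
    exact ⟨hq.out.squarefree, hr.out.squarefree⟩
  · have : 2 ≤ q := hq.out.two_le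
    have : 2 ≤ r := hr.out.two_le
    have : 4 ≤ q * r := by nlinarith
    exact_mod_cast (show q * r ≠ 1 by omega)

omit hq hr in
/-- **The twin `Wd` (a model of `(49a1^{(−q)})^{(−r)} ≅ 49a1^{(qr)}`) is a CM curve.**
[cite: SilvermanATAEC1994, App. A §3 (table of CM j-invariants)] -/
theorem hasCM_twin_prime (hq : 0 < q) (hr : 0 < r) (W : WeierstrassCurve ℚ)
    (hW : ∃ C : VariableChange ℚ, C • W = cm7.quadraticTwist ((-(q : ℤ) : ℤ) : ℚ))
    (Wd : WeierstrassCurve ℚ) [Wd.IsElliptic] (Cd : VariableChange ℚ)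
    (hWd : Cd • W.quadraticTwist ((-(r : ℤ) : ℤ) : ℚ) = Wd) : Wd.HasCM := by
  obtain ⟨C', hC'⟩ := exists_variableChange_cm7_twist_twist W hW Wd Cd hWd
  have e : cm7.quadraticTwist (((-(q : ℤ) : ℤ) : ℚ) * ((-(r : ℤ) : ℤ) : ℚ)) =
      cm7.quadraticTwist (((q * r : ℕ) : ℤ) : ℚ) := by push_cast; ring_nf
  have hne : ((q * r : ℕ) : ℤ) ≠ 0 := by positivity
  exact hasCM_of_twist_cm7 Wd hne ⟨C'⁻¹, by rw [← hC', inv_smul_smul, e]⟩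

/-- **The twin's VALUE binder `htw` from Burungale–Flach 2024 (BY NAME), prime member.**
[cite: BurungaleFlach2024, Thm 1.1 and Cor. 2] [cite: Miller2011LMS, §1 and Def. 1.1 (arXiv:1010.2431 p. 3)] -/
theorem twin_value_prime (hBF : bsdTriple_of_hasCM_of_L_one_ne_zero)
    (hGZK : rank_eq_analyticRank_of_analyticRank_le_one) (hmod : hasEntireLFunction_rat)
    (W : WeierstrassCurve ℚ) [W.IsElliptic]
    (hW : ∃ C : VariableChange ℚ, C • W = cm7.quadraticTwist ((-(q : ℤ) : ℤ) : ℚ))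
    (Wd : WeierstrassCurve ℚ) [Wd.IsElliptic] [Wd.IsGloballyMinimal] (Cd : VariableChange ℚ)
    (hWd : Cd • W.quadraticTwist ((-(r : ℤ) : ℤ) : ℚ) = Wd)
    (hLt : (W.quadraticTwist ((-(r : ℤ) : ℤ) : ℚ)).entireLFunction 1 ≠ 0) :
    ∃ x : ℚ, Wd.entireLFunction 1 / (Wd.realPeriodRat : ℂ) = (x : ℂ) ∧
      padicValRat 7 x = (padicValNat 7 Wd.shaOrder : ℤ) + padicValNat 7 Wd.tamagawaProduct -
        2 * padicValNat 7 Wd.torsionOrder := by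
  haveI : Fact (Nat.Prime 7) := ⟨by norm_num⟩
  have hCM : Wd.HasCM := hasCM_twin_prime hq.out.pos hr.out.pos W hW Wd Cd hWd
  have hL : Wd.entireLFunction 1 ≠ 0 := by
    have h' : W.quadraticTwist ((-(r : ℤ) : ℤ) : ℚ) = Cd⁻¹ • Wd := by rw [← hWd, inv_smul_smul]
    rw [h', entireLFunction_smul] at hLt
    exact hLt
  have hr0 : Wd.analyticRank = 0 := (analyticRank_eq_zero_iff_holds (W := Wd) (hmod Wd)).mpr hL
  exact X11b.Three.exists_LOne_div_realPeriodRat_of_bsdp_rankZero hGZK hmod Wd 7 hr0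
    (forall_bsdp_of_bsdTriple' Wd (hBF Wd hCM hL) 7 (by norm_num))

end Twin

end Summit.BirchSwinnertonDyer.Rank1Residual.X12.O11.RouteU

end
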